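import Literature.NumberTheory.LFunctions.WeilTwoPrimeOddMarginKBase
import Literature.NumberTheory.LFunctions.WeilBlockRows
import HarnessLib

/-!
# Two-prime odd-margin certificate K: rows 72–88 of the check `D C = I` (odd block)

Part of the odd-block check of `weilCert23K` (`WeilCert.checkDCRow`), `decide +kernel` row by row. Pure proof file; nothing is asserted.
-/

noncomputable section

namespace Literature.NumberTheory.LFunctions

set_option maxHeartbeats 0 in
/-- Kernel check of row 72 of `D C = I` (certificate K). [folklore] -/
theorem checkDCRow1_72_weilCert23K : weilCert23KBase.checkDCRow 1 72 = true := by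
  decide +kernel

set_option maxHeartbeats 0 in
/-- Kernel check of row 73 of `D C = I` (certificate K). [folklore] -/
theorem checkDCRow1_73_weilCert23K : weilCert23KBase.checkDCRow 1 73 = true := by
  decide +kernel

set_option maxHeartbeats 0 in
/-- Kernel check of row 74 of `D C = I` (certificate K). [folklore] -/
theorem checkDCRow1_74_weilCert23K : weilCert23KBase.checkDCRow 1 74 = true := by
  decide +kernel

set_option maxHeartbeats 0 in
/-- Kernel check of row 75 of `D C = I` (certificate K). [folklore] -/
theorem checkDCRow1_75_weilCert23K : weilCert23KBase.checkDCRow 1 75 = true := by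
  decide +kernel

set_option maxHeartbeats 0 in
/-- Kernel check of row 76 of `D C = I` (certificate K). [folklore] -/
theorem checkDCRow1_76_weilCert23K : weilCert23KBase.checkDCRow 1 76 = true := by
  decide +kernel

set_option maxHeartbeats 0 in
/-- Kernel check of row 77 of `D C = I` (certificate K). [folklore] -/
theorem checkDCRow1_77_weilCert23K : weilCert23KBase.checkDCRow 1 77 = true := by
  decide +kernel

set_option maxHeartbeats 0 in
/-- Kernel check of row 78 of `D C = I` (certificate K). [folklore] -/
theorem checkDCRow1_78_weilCert23K : weilCert23KBase.checkDCRow 1 78 = true := by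
  decide +kernel

set_option maxHeartbeats 0 in
/-- Kernel check of row 79 of `D C = I` (certificate K). [folklore] -/
theorem checkDCRow1_79_weilCert23K : weilCert23KBase.checkDCRow 1 79 = true := by
  decide +kernel

set_option maxHeartbeats 0 in
/-- Kernel check of row 80 of `D C = I` (certificate K). [folklore] -/
theorem checkDCRow1_80_weilCert23K : weilCert23KBase.checkDCRow 1 80 = true := by
  decide +kernel

set_option maxHeartbeats 0 in
/-- Kernel check of row 81 of `D C = I` (certificate K). [folklore] -/
theorem checkDCRow1_81_weilCert23K : weilCert23KBase.checkDCRow 1 81 = true := by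
  decide +kernel

set_option maxHeartbeats 0 in
/-- Kernel check of row 82 of `D C = I` (certificate K). [folklore] -/
theorem checkDCRow1_82_weilCert23K : weilCert23KBase.checkDCRow 1 82 = true := by
  decide +kernel

set_option maxHeartbeats 0 in
/-- Kernel check of row 83 of `D C = I` (certificate K). [folklore] -/
theorem checkDCRow1_83_weilCert23K : weilCert23KBase.checkDCRow 1 83 = true := by
  decide +kernel

set_option maxHeartbeats 0 in
/-- Kernel check of row 84 of `D C = I` (certificate K). [folklore] -/
theorem checkDCRow1_84_weilCert23K : weilCert23KBase.checkDCRow 1 84 = true := by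
  decide +kernel

set_option maxHeartbeats 0 in
/-- Kernel check of row 85 of `D C = I` (certificate K). [folklore] -/
theorem checkDCRow1_85_weilCert23K : weilCert23KBase.checkDCRow 1 85 = true := by
  decide +kernel

set_option maxHeartbeats 0 in
/-- Kernel check of row 86 of `D C = I` (certificate K). [folklore] -/
theorem checkDCRow1_86_weilCert23K : weilCert23KBase.checkDCRow 1 86 = true := by
  decide +kernel

set_option maxHeartbeats 0 in
/-- Kernel check of row 87 of `D C = I` (certificate K). [folklore] -/
theorem checkDCRow1_87_weilCert23K : weilCert23KBase.checkDCRow 1 87 = true := by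
  decide +kernel

set_option maxHeartbeats 0 in
/-- Kernel check of row 88 of `D C = I` (certificate K). [folklore] -/
theorem checkDCRow1_88_weilCert23K : weilCert23KBase.checkDCRow 1 88 = true := by
  decide +kernel


end Literature.NumberTheory.LFunctions
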